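import Summits.QuantumFields.YangMills.Theorems.BalabanUVNodesK3V5Defs
import Summits.QuantumFields.YangMills.Theorems.BalabanUVNodesN21ShellSplitOfRecord13CoPHKeyed

/-!
# N21 (NE7c) · AT THE RECORD PIN THE SHELL SPLIT OF RECORD IS EXTREMAL: every shell split whose cores are dominated by a lowered-threshold object
# and which carries N21's face `ShellWeightBound` hands that face — with the SAME budget — to the collar split `(A − lo, B − lo)`, whose face IS the
# averaged collar law `Σ (A − lo) ≤ Wsh·Σ A` (the (M1)-type estimate); kernel form of the lane's A6 items (ii) + (iv) for the K3⁸ stub-2 pin question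

R134 seat `pub-ymgap-dag-n21-d` (g17, lane owner N21), strategy s2; key K3⁸ `SpineGivenEndpointR13SepCoPHV` = stmt-QuantumFields-27366, `--kind proof --supports 27366 --as helper`;
COUNT-NEUTRAL.  Theorems only (0 `def`, 0 `sorry`, no `instance`, no `notation`).

THE QUESTION THIS FILE MAKES KERNEL-EXACT (plan g87 [YMPLAN-G87-K3-STUB2-PIN], INBOX l.40982; aid `A6-COLOCATION-AID-N21D-g13.md`, evidence #48 on 27366).  Skeleton v6
(b4e55110ab73e679) stub 2 pins the spine reading on the live line to dag-n20-d's reading of record `crOfRecord₁₃V (jc …) sh` (K3V5Defs `PinnedAtLive`); N21's conjunct there is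
`KeyedShellWeight cr` = `T4IndicatorShell.ShellWeightBound` at print's FIXED `ε`-cut class weights `weightA₁₃ ∕ weightB₁₃` with the prover-chosen shell split `sh` and the CANONICAL budget
`wshInf`.  The lane's located argument A6 says: a split there is either JUNK for N19′ (zero split, selected band: the cores handed to N19′ are not lowered-threshold objects) or needs
the UNPRINTED (M1) (split of record, `…N21ShellSplitOfRecord13CoPHKeyed` :130 ∕ :203, whose cores ARE the terms re-tested at the lowered threshold, `…ShellSplitOfRecord13CoPH` :331
`classWeight_sub_shellWeight_eq_lowered`), and «no fourth split exists».  Below, «useful to N19′» is read as the consumer's own requirement (v6 kit :140–:146; dag-n20-w2 LOCATED-2∕3):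
the cores `A − shA`, `B − shB` are DOMINATED by a lowered-threshold object `lo` with `lo ≤ A` (resp. `B`) — and then:

* §1 (abstract, any index type; [folklore] finite-sum algebra over `ShellWeightBound`'s fields):
  ★ `sum_sub_le_of_shellWeightBound_of_core_le_left ∕ _right` — N21's face for `(shA, shB)` + cores `≤ lo` ⇒ THE AVERAGED COLLAR LAW `Σ_τ (A − loA) ≤ Wsh K · Σ_τ A` (both runs);
  ★★★ `shellWeightBound_collar_of_core_le` — … ⇒ N21's face for the COLLAR SPLIT `(A − loA, B − loB)` with the SAME `Wsh` (EXTREMALITY: no split useful to N19′ beats the collar split);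
  ★★ `shellWeightBound_collar_iff` — the collar split's face ⟺ `0 ≤ Wsh`, `Σ Wsh < ∞` and the two averaged collar laws (nothing else);
  ★★ `wshInf_collar_le_wshInf` — the collar split has the LEAST canonical budget among all `lo`-dominated splits carrying the face; `shellWeightBound_collar_wshInf_of_core_le`.
* §2 (at dag-n20-d's reading of record, edition V, any offset `K₀`, any policy `jcut`, ANY keyed split `sh` and ANY keyed dominant `lo : ShellSplit₁₃CoPH N K₀`):
  `shellWeightBound_crOfRecord₁₃VAt_iff_exists` (the face AT the reading ⟺ some budget at its carriers); ★★★ `shellWeightBound_shellSplitOfRecord_iff_classSummedLaw` (A6 (ii) in the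
  kernel: at the split OF RECORD the face ⟺ the class-summed (M1) law, displayed only `0 ≤ ζ` + F3's (e1)); ★★★ `collarLaw_of_shellWeightBound_crOfRecord₁₃VAt` (N21's face AT
  `crOfRecord₁₃VAt K₀ jcut sh` + cores `≤ lo` ⇒ the keyed averaged collar law for `lo` with the reading's own canonical budget); ★★★ `shellWeightBound_carriers₁₃_collar_of_core_le`.
* §3 (KEYED, the v6 stub's literal shape): ★★★ `keyedCollarLaw_of_keyedShellWeight_of_pinnedAtLive` — for a spine reading `cr` with `PinnedAtLive jc sh cr`, N21's v6 conjunct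
  `KeyedShellWeight cr` and the domination of the cores by `lo` on the live line DELIVER, at every guarded admissible live-line tuple, the keyed averaged collar law for `lo` with a
  non-negative summable budget — i.e., with `lo :=` the split of record's OWN cores `(weightA₁₃ − shellA₁₃ ρA, weightB₁₃ − shellB₁₃ ρB)` (term by term the (2.18) class
  weights RE-TESTED AT THE LOWERED THRESHOLD `ε(1−ρ)`, `…ShellSplitOfRecord13CoPH` :331 `classWeight_sub_shellWeight_eq_lowered`), the law `Σ_x shellA₁₃ ≤ Wsh K · Σ_x weightA₁₃`
  = the class-summed form of the per-top-cube (M1) rows `hM1A ∕ hM1B` of `…ShellSplitOfRecord13CoPHKeyed` :143–:153: NOT PRINTED, NOT proved, inhabited for no family.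

RELATED, BY NAME: for ONE given split the keyed totals ⟺ the term-level totals is dag-n20-w1's `…N21KeyedShellWeightSocket` :91 `termShellTotals_of_shellWeightBound_keyed`;
what is new here is the comparison ACROSS splits (extremality) and the v6-pin keyed form.
READING (for the referee's co-location, items (a)(ii)(iv) of the aid): the split of record (ii) is a collar split — `lo :=` its own cores, `0 ≤ lo ≤ weight` being its sign rows
`shellA₁₃_nonneg ∕ shellA₁₃_le_weightA₁₃` (`…ShellSplitOfRecord13CoPHKeyed` :88–:114) — so by `shellWeightBound_collar_iff` its face IS the class-summed collar law `Σ_x shellA₁₃ ≤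
Wsh K · Σ_x weightA₁₃` (both runs, `Σ Wsh < ∞`), an averaged (M1); and by ★★★ EXTREMALITY every other split whose cores are dominated by those lowered-threshold cores implies the SAME
law with the SAME budget — a «fourth split» at the record pin cannot remove the (M1)-type input for a GENUINELY lowered `lo` (width `ρ > 0`).  The input disappears only in the
degenerate cases the aid already lists: `lo :=` print's `ε`-term itself (width zero — then the collar split IS the ZERO split and the law reads `0 ≤ Wsh·Σ A`: junk corner (i),
`…N21KeyedShellWeightShellZero` :104), or cores matched to NO lowered-threshold object (selected band, junk-grade (iii), `…N21ShellSplitSelected13CoPHKeyed` :305).  Contrast: at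
the doubly-gapped pin the same conjunct is a theorem with dial rows only (`…N21GappedPairRoadK3V6KnitZeta` p658766 `keyedShellWeight_of_gap2Pin_zeta`).

HONEST FRAMING (binding).  [folklore] bookkeeping; NO estimate of Bałaban's asserted or used; the modelling clause «useful to N19′ ⟺ cores dominated by a lowered-threshold object»
is the consumer's displayed requirement, not a theorem; NE7c at print's fixed thresholds NOT PRINTED ∕ NOT proved; (M1) NOT proved; nothing here closes `stub_expansion13HV`;
N21 NOT discharged; K3⁸ NOT claimed; skeleton v6 untouched (no route act); counts UNMOVED (typed 28∕28 · discharged 5∕27); never a count claim.  Standard axioms only.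
One finite four-torus programme at fixed `ε` — NOT ℝ⁴, NOT OS, NOT a mass gap, NOT the Clay problem.
-/

set_option autoImplicit false

noncomputable section

open scoped BigOperators
open Finset

namespace Summit.QuantumFields.YangMills.Theorems.N21RecordPinShellSplitExtremal

open Literature.MathematicalPhysics.QuantumFieldTheory.Balaban1983to89
open Literature.MathematicalPhysics.QuantumFieldTheory.Balaban1983to89.T4Continuum
open Literature.MathematicalPhysics.QuantumFieldTheory.Balaban1983to89.Node00
open T4IndicatorShell (ShellWeightBound)
open Summit.QuantumFields.YangMills.BalabanUVNodes.SpineCanonicalWeights (wshInf wshInf_nonneg wshInf_le_of_shellWeightBound shellWeightBound_wshInf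
  shellWeightBound_wshInf_iff)
open YMDAG.UVSplit (crOfRecord₁₃VAt crOfRecord₁₃V ShellSplit₁₃CoPH classSet₁₃ weightA₁₃ weightB₁₃ runA₁₃ runB₁₃ histA₁₃ histB₁₃ shellWeightBound_crOfRecord₁₃VAt)
open Summit.QuantumFields.YangMills.Theorems.N21ShellSplitOfRecord13CoPH (shellA₁₃ shellB₁₃ shellA₁₃_nonneg shellB₁₃_nonneg shellA₁₃_le_weightA₁₃ shellB₁₃_le_weightB₁₃)
open MeasureTheory (Integrable)
open Summit.QuantumFields.YangMills.Theorems.K3V5Defs (SpineReading CutReading KeyedShellWeight LiveSel PinnedAtLive)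

/-! ## §1 Abstract: the collar split is extremal among all splits with lowered-dominated cores -/

section Abstract

variable {ι : Type*} {l₀ : ℝ} {T : ℕ → Finset ι} {A B shA shB loA loB : ℕ → ℝ → ι → ℝ} {Wsh : ℕ → ℝ}

/-- ★ run A: if the shell split `(shA, shB)` carries `ShellWeightBound` with budget `Wsh` and its run-A cores are dominated by `loA` (`A − shA ≤ loA` term by term), then the
AVERAGED COLLAR LAW holds for `loA`: `Σ_τ (A − loA) ≤ Wsh K · Σ_τ A` for every step `K` and source `|t| ≤ l₀` (term by term `A − loA ≤ shA`, then the face's `left`). [folklore] -/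
theorem sum_sub_le_of_shellWeightBound_of_core_le_left (h : ShellWeightBound l₀ T A B shA shB Wsh)
    (hcoreA : ∀ (K : ℕ) (t : ℝ), |t| ≤ l₀ → ∀ τ ∈ T K, A K t τ - shA K t τ ≤ loA K t τ) (K : ℕ) (t : ℝ) (ht : |t| ≤ l₀) :
    ∑ τ ∈ T K, (A K t τ - loA K t τ) ≤ Wsh K * ∑ τ ∈ T K, A K t τ :=
  (Finset.sum_le_sum fun τ hτ => by linarith [hcoreA K t ht τ hτ]).trans (h.left K t ht)

/-- ★ run B: the same for the run-B cores dominated by `loB`: `Σ_τ (B − loB) ≤ Wsh K · Σ_τ B`. [folklore] -/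
theorem sum_sub_le_of_shellWeightBound_of_core_le_right (h : ShellWeightBound l₀ T A B shA shB Wsh)
    (hcoreB : ∀ (K : ℕ) (t : ℝ), |t| ≤ l₀ → ∀ τ ∈ T K, B K t τ - shB K t τ ≤ loB K t τ) (K : ℕ) (t : ℝ) (ht : |t| ≤ l₀) :
    ∑ τ ∈ T K, (B K t τ - loB K t τ) ≤ Wsh K * ∑ τ ∈ T K, B K t τ :=
  (Finset.sum_le_sum fun τ hτ => by linarith [hcoreB K t ht τ hτ]).trans (h.right K t ht)

/-- A dominant of a core is non-negative: `0 ≤ A − shA ≤ loA` (the face's `sh_le_left`). [folklore] -/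
theorem dominant_nonneg_left (h : ShellWeightBound l₀ T A B shA shB Wsh)
    (hcoreA : ∀ (K : ℕ) (t : ℝ), |t| ≤ l₀ → ∀ τ ∈ T K, A K t τ - shA K t τ ≤ loA K t τ) (K : ℕ) (t : ℝ) (ht : |t| ≤ l₀) (τ : ι) (hτ : τ ∈ T K) :
    0 ≤ loA K t τ := by
  linarith [hcoreA K t ht τ hτ, h.sh_le_left K t ht τ hτ]

/-- The same for run B: `0 ≤ loB`. [folklore] -/
theorem dominant_nonneg_right (h : ShellWeightBound l₀ T A B shA shB Wsh)
    (hcoreB : ∀ (K : ℕ) (t : ℝ), |t| ≤ l₀ → ∀ τ ∈ T K, B K t τ - shB K t τ ≤ loB K t τ) (K : ℕ) (t : ℝ) (ht : |t| ≤ l₀) (τ : ι) (hτ : τ ∈ T K) :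
    0 ≤ loB K t τ := by
  linarith [hcoreB K t ht τ hτ, h.sh_le_right K t ht τ hτ]

/-- ★★★ **EXTREMALITY OF THE COLLAR SPLIT.**  If ANY shell split `(shA, shB)` carries N21's face `ShellWeightBound l₀ T A B shA shB Wsh` and its cores are dominated by a
lowered object `(loA, loB)` not exceeding the terms (`A − shA ≤ loA ≤ A`, `B − shB ≤ loB ≤ B`), then the COLLAR SPLIT `(A − loA, B − loB)` carries N21's face WITH THE SAME
BUDGET `Wsh`.  (So among all splits useful to a consumer that needs lowered-dominated cores, the collar split is without loss of generality.) [folklore] -/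
theorem shellWeightBound_collar_of_core_le (h : ShellWeightBound l₀ T A B shA shB Wsh)
    (hcoreA : ∀ (K : ℕ) (t : ℝ), |t| ≤ l₀ → ∀ τ ∈ T K, A K t τ - shA K t τ ≤ loA K t τ)
    (hcoreB : ∀ (K : ℕ) (t : ℝ), |t| ≤ l₀ → ∀ τ ∈ T K, B K t τ - shB K t τ ≤ loB K t τ)
    (hloA : ∀ (K : ℕ) (t : ℝ), |t| ≤ l₀ → ∀ τ ∈ T K, loA K t τ ≤ A K t τ)
    (hloB : ∀ (K : ℕ) (t : ℝ), |t| ≤ l₀ → ∀ τ ∈ T K, loB K t τ ≤ B K t τ) :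
    ShellWeightBound l₀ T A B (fun K t τ => A K t τ - loA K t τ) (fun K t τ => B K t τ - loB K t τ) Wsh where
  nonneg := h.nonneg
  summable := h.summable
  sh_nonneg_left K t ht τ hτ := sub_nonneg.2 (hloA K t ht τ hτ)
  sh_le_left K t ht τ hτ := sub_le_self _ (dominant_nonneg_left h hcoreA K t ht τ hτ)
  sh_nonneg_right K t ht τ hτ := sub_nonneg.2 (hloB K t ht τ hτ)
  sh_le_right K t ht τ hτ := sub_le_self _ (dominant_nonneg_right h hcoreB K t ht τ hτ)
  left := sum_sub_le_of_shellWeightBound_of_core_le_left h hcoreA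
  right := sum_sub_le_of_shellWeightBound_of_core_le_right h hcoreB

/-- ★★ **THE COLLAR SPLIT'S FACE IS EXACTLY THE AVERAGED COLLAR LAW.**  For a lowered object with `0 ≤ loA ≤ A`, `0 ≤ loB ≤ B` on the terms, `ShellWeightBound` for the
collar split `(A − loA, B − loB)` with budget `Wsh` holds IFF `0 ≤ Wsh`, `Σ_K Wsh K < ∞`, and the two averaged collar laws `Σ_τ (A − loA) ≤ Wsh K · Σ_τ A`,
`Σ_τ (B − loB) ≤ Wsh K · Σ_τ B` (`|t| ≤ l₀`) — the term-wise clauses of the face are automatic. [folklore] -/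
theorem shellWeightBound_collar_iff
    (hloA : ∀ (K : ℕ) (t : ℝ), |t| ≤ l₀ → ∀ τ ∈ T K, 0 ≤ loA K t τ ∧ loA K t τ ≤ A K t τ)
    (hloB : ∀ (K : ℕ) (t : ℝ), |t| ≤ l₀ → ∀ τ ∈ T K, 0 ≤ loB K t τ ∧ loB K t τ ≤ B K t τ) :
    ShellWeightBound l₀ T A B (fun K t τ => A K t τ - loA K t τ) (fun K t τ => B K t τ - loB K t τ) Wsh ↔
      (∀ K, 0 ≤ Wsh K) ∧ Summable Wsh ∧
        (∀ (K : ℕ) (t : ℝ), |t| ≤ l₀ → ∑ τ ∈ T K, (A K t τ - loA K t τ) ≤ Wsh K * ∑ τ ∈ T K, A K t τ) ∧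
        (∀ (K : ℕ) (t : ℝ), |t| ≤ l₀ → ∑ τ ∈ T K, (B K t τ - loB K t τ) ≤ Wsh K * ∑ τ ∈ T K, B K t τ) := by
  refine ⟨fun h => ⟨h.nonneg, h.summable, h.left, h.right⟩, fun ⟨h0, hs, hl, hr⟩ => ?_⟩
  exact
    { nonneg := h0
      summable := hs
      sh_nonneg_left := fun K t ht τ hτ => sub_nonneg.2 (hloA K t ht τ hτ).2
      sh_le_left := fun K t ht τ hτ => sub_le_self _ (hloA K t ht τ hτ).1
      sh_nonneg_right := fun K t ht τ hτ => sub_nonneg.2 (hloB K t ht τ hτ).2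
      sh_le_right := fun K t ht τ hτ => sub_le_self _ (hloB K t ht τ hτ).1
      left := hl
      right := hr }

/-- ★ Once the term-wise sign clauses `0 ≤ sh ≤ term` are known, N21's face for `(shA, shB)` with budget `Wsh` IS the pair of averaged laws `Σ shA ≤ Wsh K · Σ A`,
`Σ shB ≤ Wsh K · Σ B` with `0 ≤ Wsh`, `Σ Wsh < ∞` — nothing else (the structure's fields, regrouped). [folklore] -/
theorem shellWeightBound_iff_laws_of_signs
    (h0A : ∀ (K : ℕ) (t : ℝ), |t| ≤ l₀ → ∀ τ ∈ T K, 0 ≤ shA K t τ) (hleA : ∀ (K : ℕ) (t : ℝ), |t| ≤ l₀ → ∀ τ ∈ T K, shA K t τ ≤ A K t τ)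
    (h0B : ∀ (K : ℕ) (t : ℝ), |t| ≤ l₀ → ∀ τ ∈ T K, 0 ≤ shB K t τ) (hleB : ∀ (K : ℕ) (t : ℝ), |t| ≤ l₀ → ∀ τ ∈ T K, shB K t τ ≤ B K t τ) :
    ShellWeightBound l₀ T A B shA shB Wsh ↔
      (∀ K, 0 ≤ Wsh K) ∧ Summable Wsh ∧
        (∀ (K : ℕ) (t : ℝ), |t| ≤ l₀ → ∑ τ ∈ T K, shA K t τ ≤ Wsh K * ∑ τ ∈ T K, A K t τ) ∧
        (∀ (K : ℕ) (t : ℝ), |t| ≤ l₀ → ∑ τ ∈ T K, shB K t τ ≤ Wsh K * ∑ τ ∈ T K, B K t τ) :=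
  ⟨fun h => ⟨h.nonneg, h.summable, h.left, h.right⟩, fun ⟨h0, hs, hl, hr⟩ =>
    { nonneg := h0, summable := hs, sh_nonneg_left := h0A, sh_le_left := hleA, sh_nonneg_right := h0B, sh_le_right := hleB, left := hl, right := hr }⟩

/-- ★★ **THE COLLAR SPLIT HAS THE LEAST CANONICAL BUDGET** among all splits with `lo`-dominated cores carrying the face: `wshInf(collar) K ≤ wshInf(shA, shB) K` for every `K`
(extremality applied at the canonical budget of `(shA, shB)`, then `wshInf_le_of_shellWeightBound`). [folklore] -/
theorem wshInf_collar_le_wshInf (h : ShellWeightBound l₀ T A B shA shB Wsh)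
    (hcoreA : ∀ (K : ℕ) (t : ℝ), |t| ≤ l₀ → ∀ τ ∈ T K, A K t τ - shA K t τ ≤ loA K t τ)
    (hcoreB : ∀ (K : ℕ) (t : ℝ), |t| ≤ l₀ → ∀ τ ∈ T K, B K t τ - shB K t τ ≤ loB K t τ)
    (hloA : ∀ (K : ℕ) (t : ℝ), |t| ≤ l₀ → ∀ τ ∈ T K, loA K t τ ≤ A K t τ)
    (hloB : ∀ (K : ℕ) (t : ℝ), |t| ≤ l₀ → ∀ τ ∈ T K, loB K t τ ≤ B K t τ) (K : ℕ) :
    wshInf l₀ T A B (fun K t τ => A K t τ - loA K t τ) (fun K t τ => B K t τ - loB K t τ) K ≤ wshInf l₀ T A B shA shB K :=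
  wshInf_le_of_shellWeightBound (shellWeightBound_collar_of_core_le (shellWeightBound_wshInf h) hcoreA hcoreB hloA hloB) K

/-- ★ Canonical-budget form of extremality: the face for `(shA, shB)` at ITS canonical budget hands the collar split the face at the COLLAR's canonical budget. [folklore] -/
theorem shellWeightBound_collar_wshInf_of_core_le (h : ShellWeightBound l₀ T A B shA shB Wsh)
    (hcoreA : ∀ (K : ℕ) (t : ℝ), |t| ≤ l₀ → ∀ τ ∈ T K, A K t τ - shA K t τ ≤ loA K t τ)
    (hcoreB : ∀ (K : ℕ) (t : ℝ), |t| ≤ l₀ → ∀ τ ∈ T K, B K t τ - shB K t τ ≤ loB K t τ)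
    (hloA : ∀ (K : ℕ) (t : ℝ), |t| ≤ l₀ → ∀ τ ∈ T K, loA K t τ ≤ A K t τ)
    (hloB : ∀ (K : ℕ) (t : ℝ), |t| ≤ l₀ → ∀ τ ∈ T K, loB K t τ ≤ B K t τ) :
    ShellWeightBound l₀ T A B (fun K t τ => A K t τ - loA K t τ) (fun K t τ => B K t τ - loB K t τ)
      (wshInf l₀ T A B (fun K t τ => A K t τ - loA K t τ) (fun K t τ => B K t τ - loB K t τ)) :=
  shellWeightBound_wshInf (shellWeightBound_collar_of_core_le h hcoreA hcoreB hloA hloB)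

end Abstract

/-! ## §2 At dag-n20-d's reading of record (edition V, offset `K₀`, policy `jcut`): any keyed split `sh`, any keyed dominant `lo` -/

section AtRecord

variable {F : T4Family} {N : ℕ} [NeZero N]

/-- N21's face AT the reading of record `crOfRecord₁₃VAt K₀ jcut sh` (its own fields, canonical budget `wshInf`) holds IFF `ShellWeightBound` holds at the reading's carriers
`(classSet₁₃, weightA₁₃, weightB₁₃, sh.1, sh.2)` with SOME budget (`shellWeightBound_wshInf_iff`; the fields are the carriers by `rfl`). [bookkeeping] -/
theorem shellWeightBound_crOfRecord₁₃VAt_iff_exists (K₀ : ℕ) (jcut : ℕ → ℕ) (sh : ShellSplit₁₃CoPH N K₀) (θ : Stage13HParams F N) (hP : θ.Provisos₁₃CoPH F N)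
    (g₀ : ℕ → ℝ) (os : List (ULoop F)) :
    ShellWeightBound (crOfRecord₁₃VAt K₀ jcut sh F θ hP g₀ os).l₀ (crOfRecord₁₃VAt K₀ jcut sh F θ hP g₀ os).T (crOfRecord₁₃VAt K₀ jcut sh F θ hP g₀ os).A
        (crOfRecord₁₃VAt K₀ jcut sh F θ hP g₀ os).B (crOfRecord₁₃VAt K₀ jcut sh F θ hP g₀ os).shA (crOfRecord₁₃VAt K₀ jcut sh F θ hP g₀ os).shB
        (crOfRecord₁₃VAt K₀ jcut sh F θ hP g₀ os).Wsh ↔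
      ∃ Wsh : ℕ → ℝ, ShellWeightBound 1 (classSet₁₃ θ K₀ g₀) (weightA₁₃ θ hP K₀ g₀ os) (weightB₁₃ θ hP K₀ g₀ os) (sh F θ hP g₀ os).1 (sh F θ hP g₀ os).2 Wsh :=
  shellWeightBound_wshInf_iff

/-- ★★★ **AT THE RECORD PIN, N21's FACE FOR A SPLIT WITH LOWERED-DOMINATED CORES DELIVERS THE KEYED AVERAGED COLLAR LAW.**  If N21's face holds AT
`crOfRecord₁₃VAt K₀ jcut sh` and the split's cores are dominated key by key by `lo` (`weightA₁₃ − sh.1 ≤ lo.1`, `weightB₁₃ − sh.2 ≤ lo.2` on the class set, `|t| ≤ 1`), then for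
every step `K`: `Σ_x (weightA₁₃ − lo.1) ≤ Wsh K · Σ_x weightA₁₃` and `Σ_x (weightB₁₃ − lo.2) ≤ Wsh K · Σ_x weightB₁₃` with `Wsh` = the reading's OWN canonical budget.  With `lo :=`
the record's lowered-threshold cores this is an averaged (M1) at print's fixed letter — NOT PRINTED. [bookkeeping] -/
theorem collarLaw_of_shellWeightBound_crOfRecord₁₃VAt (K₀ : ℕ) (jcut : ℕ → ℕ) (sh lo : ShellSplit₁₃CoPH N K₀) (θ : Stage13HParams F N) (hP : θ.Provisos₁₃CoPH F N)
    (g₀ : ℕ → ℝ) (os : List (ULoop F))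
    (h : ShellWeightBound (crOfRecord₁₃VAt K₀ jcut sh F θ hP g₀ os).l₀ (crOfRecord₁₃VAt K₀ jcut sh F θ hP g₀ os).T (crOfRecord₁₃VAt K₀ jcut sh F θ hP g₀ os).A
        (crOfRecord₁₃VAt K₀ jcut sh F θ hP g₀ os).B (crOfRecord₁₃VAt K₀ jcut sh F θ hP g₀ os).shA (crOfRecord₁₃VAt K₀ jcut sh F θ hP g₀ os).shB
        (crOfRecord₁₃VAt K₀ jcut sh F θ hP g₀ os).Wsh)
    (hcoreA : ∀ (K : ℕ) (t : ℝ), |t| ≤ 1 → ∀ x ∈ classSet₁₃ θ K₀ g₀ K, weightA₁₃ θ hP K₀ g₀ os K t x - (sh F θ hP g₀ os).1 K t x ≤ (lo F θ hP g₀ os).1 K t x)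
    (hcoreB : ∀ (K : ℕ) (t : ℝ), |t| ≤ 1 → ∀ x ∈ classSet₁₃ θ K₀ g₀ K, weightB₁₃ θ hP K₀ g₀ os K t x - (sh F θ hP g₀ os).2 K t x ≤ (lo F θ hP g₀ os).2 K t x)
    (K : ℕ) (t : ℝ) (ht : |t| ≤ 1) :
    ∑ x ∈ classSet₁₃ θ K₀ g₀ K, (weightA₁₃ θ hP K₀ g₀ os K t x - (lo F θ hP g₀ os).1 K t x) ≤
        (crOfRecord₁₃VAt K₀ jcut sh F θ hP g₀ os).Wsh K * ∑ x ∈ classSet₁₃ θ K₀ g₀ K, weightA₁₃ θ hP K₀ g₀ os K t x ∧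
      ∑ x ∈ classSet₁₃ θ K₀ g₀ K, (weightB₁₃ θ hP K₀ g₀ os K t x - (lo F θ hP g₀ os).2 K t x) ≤
        (crOfRecord₁₃VAt K₀ jcut sh F θ hP g₀ os).Wsh K * ∑ x ∈ classSet₁₃ θ K₀ g₀ K, weightB₁₃ θ hP K₀ g₀ os K t x :=
  ⟨sum_sub_le_of_shellWeightBound_of_core_le_left h hcoreA K t ht, sum_sub_le_of_shellWeightBound_of_core_le_right h hcoreB K t ht⟩

/-- ★★★ **AT THE RECORD PIN THE COLLAR SPLIT INHERITS N21's FACE** (extremality at the reading): if N21's face holds AT `crOfRecord₁₃VAt K₀ jcut sh`, the cores are dominated by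
`lo`, and `lo` does not exceed the class weights, then N21's face holds AT the reading of record RE-PINNED AT THE COLLAR SPLIT `(weightA₁₃ − lo.1, weightB₁₃ − lo.2)` (same runs,
keys, class set, weights, bad class; its own canonical budget) — no split useful to N19′ does better than the collar split. [bookkeeping] -/
theorem shellWeightBound_crOfRecord₁₃VAt_collar_of_core_le (K₀ : ℕ) (jcut : ℕ → ℕ) (sh lo : ShellSplit₁₃CoPH N K₀) (F : T4Family) (θ : Stage13HParams F N)
    (hP : θ.Provisos₁₃CoPH F N) (g₀ : ℕ → ℝ) (os : List (ULoop F))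
    (h : ShellWeightBound (crOfRecord₁₃VAt K₀ jcut sh F θ hP g₀ os).l₀ (crOfRecord₁₃VAt K₀ jcut sh F θ hP g₀ os).T (crOfRecord₁₃VAt K₀ jcut sh F θ hP g₀ os).A
        (crOfRecord₁₃VAt K₀ jcut sh F θ hP g₀ os).B (crOfRecord₁₃VAt K₀ jcut sh F θ hP g₀ os).shA (crOfRecord₁₃VAt K₀ jcut sh F θ hP g₀ os).shB
        (crOfRecord₁₃VAt K₀ jcut sh F θ hP g₀ os).Wsh)
    (hcoreA : ∀ (K : ℕ) (t : ℝ), |t| ≤ 1 → ∀ x ∈ classSet₁₃ θ K₀ g₀ K, weightA₁₃ θ hP K₀ g₀ os K t x - (sh F θ hP g₀ os).1 K t x ≤ (lo F θ hP g₀ os).1 K t x)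
    (hcoreB : ∀ (K : ℕ) (t : ℝ), |t| ≤ 1 → ∀ x ∈ classSet₁₃ θ K₀ g₀ K, weightB₁₃ θ hP K₀ g₀ os K t x - (sh F θ hP g₀ os).2 K t x ≤ (lo F θ hP g₀ os).2 K t x)
    (hloA : ∀ (K : ℕ) (t : ℝ), |t| ≤ 1 → ∀ x ∈ classSet₁₃ θ K₀ g₀ K, (lo F θ hP g₀ os).1 K t x ≤ weightA₁₃ θ hP K₀ g₀ os K t x)
    (hloB : ∀ (K : ℕ) (t : ℝ), |t| ≤ 1 → ∀ x ∈ classSet₁₃ θ K₀ g₀ K, (lo F θ hP g₀ os).2 K t x ≤ weightB₁₃ θ hP K₀ g₀ os K t x) :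
    let crc := crOfRecord₁₃VAt K₀ jcut
      (fun F θ hP g₀ os => (fun K t x => weightA₁₃ θ hP K₀ g₀ os K t x - (lo F θ hP g₀ os).1 K t x,
        fun K t x => weightB₁₃ θ hP K₀ g₀ os K t x - (lo F θ hP g₀ os).2 K t x)) F θ hP g₀ os
    ShellWeightBound crc.l₀ crc.T crc.A crc.B crc.shA crc.shB crc.Wsh :=
  shellWeightBound_crOfRecord₁₃VAt K₀ jcut _ θ hP g₀ os (shellWeightBound_collar_of_core_le h hcoreA hcoreB hloA hloB)

/-- ★★★ **(A6 (ii) IN THE KERNEL) N21's FACE AT THE SPLIT OF RECORD IS EXACTLY THE CLASS-SUMMED (M1) LAW.**  At a `CoPH`-keyed Stage-13 tuple and offset `K₀`, for the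
split OF RECORD `(shellA₁₃ ρA, shellB₁₃ ρB)` (shell = the class weight carried where every top cube passes the (2.17) test at print's `ε` but some top cube fails it at the LOWERED
`ε(1−ρ)`, `…ShellSplitOfRecord13CoPHDefs` :108): displayed only `0 ≤ ζ` and F3's (e1) integrability (the sign rows' own inputs, `…ShellSplitOfRecord13CoPHKeyed` :88–:114).  THEN
`ShellWeightBound` at the record carriers with budget `Wsh` ⟺ `0 ≤ Wsh`, `Σ_K Wsh K < ∞`, and per run, per `(K, |t| ≤ 1)`: `Σ_x shellA₁₃ ≤ Wsh K · Σ_x weightA₁₃`,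
`Σ_x shellB₁₃ ≤ Wsh K · Σ_x weightB₁₃` — the class-summed form of the per-top-cube (M1) rows (`…Keyed` :143–:153 give it with `Wsh K = (2L^m)⁴(D^A_K ρ^A_K + D^B_K ρ^B_K)`).
NOT PRINTED at print's fixed letter; NOT proved; inhabited for no family. [bookkeeping] -/
theorem shellWeightBound_shellSplitOfRecord_iff_classSummedLaw (K₀ : ℕ) (θ : Stage13HParams F N) (hP : θ.Provisos₁₃CoPH F N) (g₀ : ℕ → ℝ) (os : List (ULoop F))
    (hζ0 : ∀ p g k s Pl Ql RS U V', 0 ≤ θ.ζ p g k s Pl Ql RS U V')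
    (hintA : ∀ (K : ℕ) (t : ℝ) (s : SeqOfRecord F θ.ν θ.τ9.M (histA₁₃ θ K₀ g₀ K) (K₀ + K) (K₀ + K)),
      Integrable (fun V => chiSeqOfRecord F N θ.ν θ.τ9.M (histA₁₃ θ K₀ g₀ K) (K₀ + K) (K₀ + K) s V *
        dressedSlotsOfDatum₉ F N θ.toStage9Params (datumOfRecord₁₃CoPH F N θ hP) g₀ os t (runA₁₃ F K₀ g₀ K) (histA₁₃ θ K₀ g₀ K) (K₀ + K) s V)
        (fieldMeasure (F.P (K₀ + K)) (K₀ + K) (SU N)))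
    (hintB : ∀ (K : ℕ) (t : ℝ) (s' : SeqOfRecord F θ.ν θ.τ9.M (histB₁₃ θ K₀ g₀ K) (K₀ + K + 1) (K₀ + K + 1)),
      Integrable (fun V => chiSeqOfRecord F N θ.ν θ.τ9.M (histB₁₃ θ K₀ g₀ K) (K₀ + K + 1) (K₀ + K + 1) s' V *
        dressedSlotsOfDatum₉ F N θ.toStage9Params (datumOfRecord₁₃CoPH F N θ hP) g₀ os t (runB₁₃ F K₀ g₀ K) (histB₁₃ θ K₀ g₀ K) (K₀ + K + 1) s' V)
        (fieldMeasure (F.P (K₀ + K + 1)) (K₀ + K + 1) (SU N)))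
    (ρA ρB Wsh : ℕ → ℝ) :
    ShellWeightBound 1 (classSet₁₃ θ K₀ g₀) (weightA₁₃ θ hP K₀ g₀ os) (weightB₁₃ θ hP K₀ g₀ os) (shellA₁₃ θ hP K₀ g₀ os ρA) (shellB₁₃ θ hP K₀ g₀ os ρB) Wsh ↔
      (∀ K, 0 ≤ Wsh K) ∧ Summable Wsh ∧
        (∀ (K : ℕ) (t : ℝ), |t| ≤ 1 →
          ∑ x ∈ classSet₁₃ θ K₀ g₀ K, shellA₁₃ θ hP K₀ g₀ os ρA K t x ≤ Wsh K * ∑ x ∈ classSet₁₃ θ K₀ g₀ K, weightA₁₃ θ hP K₀ g₀ os K t x) ∧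
        (∀ (K : ℕ) (t : ℝ), |t| ≤ 1 →
          ∑ x ∈ classSet₁₃ θ K₀ g₀ K, shellB₁₃ θ hP K₀ g₀ os ρB K t x ≤ Wsh K * ∑ x ∈ classSet₁₃ θ K₀ g₀ K, weightB₁₃ θ hP K₀ g₀ os K t x) :=
  shellWeightBound_iff_laws_of_signs (fun K t _ x _ => shellA₁₃_nonneg K₀ θ hP g₀ os hζ0 ρA K t x)
    (fun K t _ x _ => shellA₁₃_le_weightA₁₃ K₀ θ hP g₀ os hζ0 hintA ρA K t x) (fun K t _ x _ => shellB₁₃_nonneg K₀ θ hP g₀ os hζ0 ρB K t x)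
    (fun K t _ x _ => shellB₁₃_le_weightB₁₃ K₀ θ hP g₀ os hζ0 hintB ρB K t x)

end AtRecord

/-! ## §3 Keyed, in the v6 stub's literal shape: `PinnedAtLive jc sh cr` and `KeyedShellWeight cr` -/

section Keyed

/-- ★★★ **THE v6 CONJUNCT AT THE RECORD PIN DELIVERS THE KEYED AVERAGED COLLAR LAW.**  Let the spine reading `cr` be pinned on the live-selector line to dag-n20-d's reading of
record with split `sh` (`PinnedAtLive jc sh cr`, skeleton v6 stub 2's pin) and carry N21's v6 conjunct `KeyedShellWeight cr`.  If on the live line the split's cores are dominated by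
a keyed object `lo` (the consumer's «lowered-threshold cores» requirement), then at EVERY guarded admissible live-line tuple the keyed averaged collar law for `lo` holds in both runs with
a non-negative summable budget.  With `lo :=` the split of record's own cores (the class weights re-tested at the lowered threshold, `…ShellSplitOfRecord13CoPH` :331) this is
the class-summed form of the per-top-cube (M1): NOT PRINTED, NOT proved — the v6 pin's N21 conjunct cannot be closed for such a split without it. [bookkeeping] -/
theorem keyedCollarLaw_of_keyedShellWeight_of_pinnedAtLive (jc : CutReading) (sh lo : ShellSplit₁₃CoPH 2 0) {cr : SpineReading} (hpin : PinnedAtLive jc sh cr)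
    (h21 : KeyedShellWeight cr)
    (hcoreA : ∀ (F : T4Family) (θ : Stage13HParams F 2) (hP : θ.Provisos₁₃CoPH F 2) (g₀ : ℕ → ℝ) (os : List (ULoop F)), LiveSel F θ →
      ∀ (K : ℕ) (t : ℝ), |t| ≤ 1 → ∀ x ∈ classSet₁₃ θ 0 g₀ K, weightA₁₃ θ hP 0 g₀ os K t x - (sh F θ hP g₀ os).1 K t x ≤ (lo F θ hP g₀ os).1 K t x)
    (hcoreB : ∀ (F : T4Family) (θ : Stage13HParams F 2) (hP : θ.Provisos₁₃CoPH F 2) (g₀ : ℕ → ℝ) (os : List (ULoop F)), LiveSel F θ →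
      ∀ (K : ℕ) (t : ℝ), |t| ≤ 1 → ∀ x ∈ classSet₁₃ θ 0 g₀ K, weightB₁₃ θ hP 0 g₀ os K t x - (sh F θ hP g₀ os).2 K t x ≤ (lo F θ hP g₀ os).2 K t x) :
    ∀ (F : T4Family) (θ : Stage13HParams F 2) (hP : θ.Provisos₁₃CoPH F 2), (θ.ZhUnity F 2 ∧ θ.SlotsNondegenerate₁₃ F 2) → θ.Admissible F 2 → LiveSel F θ →
      ∀ (g₀ : ℕ → ℝ) (os : List (ULoop F)), ∃ Wsh : ℕ → ℝ, (∀ K, 0 ≤ Wsh K) ∧ Summable Wsh ∧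
        (∀ (K : ℕ) (t : ℝ), |t| ≤ 1 →
          ∑ x ∈ classSet₁₃ θ 0 g₀ K, (weightA₁₃ θ hP 0 g₀ os K t x - (lo F θ hP g₀ os).1 K t x) ≤ Wsh K * ∑ x ∈ classSet₁₃ θ 0 g₀ K, weightA₁₃ θ hP 0 g₀ os K t x) ∧
        (∀ (K : ℕ) (t : ℝ), |t| ≤ 1 →
          ∑ x ∈ classSet₁₃ θ 0 g₀ K, (weightB₁₃ θ hP 0 g₀ os K t x - (lo F θ hP g₀ os).2 K t x) ≤ Wsh K * ∑ x ∈ classSet₁₃ θ 0 g₀ K, weightB₁₃ θ hP 0 g₀ os K t x) := by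
  intro F θ hP hg hadm hlive g₀ os
  have hsw := h21 F θ hP hg hadm g₀ os
  rw [hpin F θ hP g₀ os hlive] at hsw
  exact ⟨_, hsw.nonneg, hsw.summable, sum_sub_le_of_shellWeightBound_of_core_le_left hsw (hcoreA F θ hP g₀ os hlive),
    sum_sub_le_of_shellWeightBound_of_core_le_right hsw (hcoreB F θ hP g₀ os hlive)⟩

/-- ★★★ **KEYED EXTREMALITY: THE v6 CONJUNCT TRANSFERS FROM ANY LOWERED-DOMINATED SPLIT TO THE COLLAR SPLIT.**  Let `cr` be pinned to the reading of record with split `sh` and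
`cr'` to the reading of record with the COLLAR SPLIT `(weightA₁₃ − lo.1, weightB₁₃ − lo.2)`, the two readings agreeing off the live line.  If `cr` carries `KeyedShellWeight` and on the
live line its cores are dominated by `lo ≤` the class weights, then `cr'` carries `KeyedShellWeight` — among all splits useful to N19′ the collar split (the split of record's type) is
without loss of generality for v6 stub 2's N21 conjunct. [bookkeeping] -/
theorem keyedShellWeight_collar_of_keyedShellWeight_of_pinnedAtLive (jc : CutReading) (sh lo : ShellSplit₁₃CoPH 2 0) {cr cr' : SpineReading}
    (hpin : PinnedAtLive jc sh cr)
    (hpin' : PinnedAtLive jc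
      (fun F θ hP g₀ os => (fun K t x => weightA₁₃ θ hP 0 g₀ os K t x - (lo F θ hP g₀ os).1 K t x,
        fun K t x => weightB₁₃ θ hP 0 g₀ os K t x - (lo F θ hP g₀ os).2 K t x)) cr')
    (hoff : ∀ (F : T4Family) (θ : Stage13HParams F 2) (hP : θ.Provisos₁₃CoPH F 2) (g₀ : ℕ → ℝ) (os : List (ULoop F)),
      ¬ LiveSel F θ → cr' F θ hP g₀ os = cr F θ hP g₀ os)
    (h21 : KeyedShellWeight cr)
    (hcoreA : ∀ (F : T4Family) (θ : Stage13HParams F 2) (hP : θ.Provisos₁₃CoPH F 2) (g₀ : ℕ → ℝ) (os : List (ULoop F)), LiveSel F θ →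
      ∀ (K : ℕ) (t : ℝ), |t| ≤ 1 → ∀ x ∈ classSet₁₃ θ 0 g₀ K, weightA₁₃ θ hP 0 g₀ os K t x - (sh F θ hP g₀ os).1 K t x ≤ (lo F θ hP g₀ os).1 K t x)
    (hcoreB : ∀ (F : T4Family) (θ : Stage13HParams F 2) (hP : θ.Provisos₁₃CoPH F 2) (g₀ : ℕ → ℝ) (os : List (ULoop F)), LiveSel F θ →
      ∀ (K : ℕ) (t : ℝ), |t| ≤ 1 → ∀ x ∈ classSet₁₃ θ 0 g₀ K, weightB₁₃ θ hP 0 g₀ os K t x - (sh F θ hP g₀ os).2 K t x ≤ (lo F θ hP g₀ os).2 K t x)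
    (hloA : ∀ (F : T4Family) (θ : Stage13HParams F 2) (hP : θ.Provisos₁₃CoPH F 2) (g₀ : ℕ → ℝ) (os : List (ULoop F)), LiveSel F θ →
      ∀ (K : ℕ) (t : ℝ), |t| ≤ 1 → ∀ x ∈ classSet₁₃ θ 0 g₀ K, (lo F θ hP g₀ os).1 K t x ≤ weightA₁₃ θ hP 0 g₀ os K t x)
    (hloB : ∀ (F : T4Family) (θ : Stage13HParams F 2) (hP : θ.Provisos₁₃CoPH F 2) (g₀ : ℕ → ℝ) (os : List (ULoop F)), LiveSel F θ →
      ∀ (K : ℕ) (t : ℝ), |t| ≤ 1 → ∀ x ∈ classSet₁₃ θ 0 g₀ K, (lo F θ hP g₀ os).2 K t x ≤ weightB₁₃ θ hP 0 g₀ os K t x) :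
    KeyedShellWeight cr' := by
  intro F θ hP hg hadm g₀ os
  have hsw := h21 F θ hP hg hadm g₀ os
  by_cases hlive : LiveSel F θ
  · rw [hpin F θ hP g₀ os hlive] at hsw
    rw [hpin' F θ hP g₀ os hlive]
    exact shellWeightBound_crOfRecord₁₃VAt 0 (jc F θ hP g₀ os) _ θ hP g₀ os (shellWeightBound_collar_of_core_le hsw (hcoreA F θ hP g₀ os hlive)
      (hcoreB F θ hP g₀ os hlive) (hloA F θ hP g₀ os hlive) (hloB F θ hP g₀ os hlive))
  · rw [hoff F θ hP g₀ os hlive]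
    exact hsw

end Keyed

end Summit.QuantumFields.YangMills.Theorems.N21RecordPinShellSplitExtremal

end
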